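import Literature.AlgebraicGeometry.Frobenioids.ModelFrobenioidPreFrobenioid
import Literature.AlgebraicGeometry.Frobenioids.ModelFrobenioidFunctorIso
import HarnessLib

/-!
# Frobenioids I, Thm. 5.2 (iv) / Prop. 5.6: twisted unit cocycles on a model Frobenioid — the
# "various units obtained in Proposition 5.6", part 1 (cocycle calculus)

Mochizuki, *The geometry of Frobenioids I: the general theory*, Kyushu J. Math. **62** (2008)
293–400, §5, Theorem 5.2 (i) p. 100 (morphisms of the model Frobenioid of `(Φ, B, Div_B)` ARE the
quadruples `(deg_Fr, Base, Div, u)`, composition `u_{ψ∘φ} = Base(φ)^* u_ψ + deg_Fr(ψ) · u_φ`), the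
construction of the comparison equivalence of Theorem 5.2 (iv) pp. 101–103 ("for the final entry, it
follows from the existence of the unique factorizations …") and Proposition 5.6 p. 105 (base-Frobenius
pairs "determined … up to conjugation [as a pair!] by an element of `O^×(A)`"), with the unit computation of
[IUTchI] Remark 5.3.3 p. 146 (`c_p = c_2^{p−1}`) [cite: MochizukiFrdI2008, Thm. 5.2 p.100].

PROOF-ONLY (abc-iut cell, row «S2′ FRDI-SELFEQUIV-RIGIDITY AT PRINT STRENGTH», this file abc-iut-L1-t7;
sequel of `ModelFrobenioidSelfEquivalenceRigidity.lean`).  SETTING: `C = ModelFrobenioid Φ B DivB`, `B`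
objectwise group-like (`hB`), and an abstract TWISTED UNIT COCYCLE `κ` — to every morphism `φ : X → Y` an
element `κ(φ) ∈ B(Base X)` with (K1) `κ(ψ ∘ φ) = Base(φ)^* κ(ψ) · κ(φ)^{deg_Fr ψ}` (the composition law of the
unit entry `u_φ` itself) and (K2) `κ(f) · u_g = κ(g) · u_f` for PARALLEL LINEAR `f, g` over the same base
arrow (i.e. `κ/u` is a function of the birational unit).  The unit entry `u` is such a cocycle; so is the
read-back `(e_X⁻¹)^* u_{Ψ φ}` of the unit entries of a functor `Ψ` lying over the identity that induces the
identity on the rational function monoid (part 2, `ModelFrobenioidSelfEquivalenceRigidityUnits.lean`).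
CONTENT: for each object `X` there is a unit `ω_X ∈ B(Base X)` — characterised inverse-free by
`ω_X · κ(s₀) = κ(F) · κ(s)` for EVERY "fraction presentation" of `X` (linear base-identity unit-free arrows
`s : X → (A, δ)`, `s₀ : (A, 0) → (A, δ)` and the degree-`2` Frobenius endomorphism `F` of `(A, 0)`;
`exists_omega`, `kappa_frac_indep`) — such that along the three kinds of generating arrows (Frobenius
`(d, id, 0, 1)`, linear base-identity `(1, id, z, u)`, pull-back `(1, b, 0, 1)`) one has
`κ(φ) · Base(φ)^* ω_Y = u_φ · ω_X^{deg_Fr φ}` (`kappa_frob`, `kappa_linear`, `kappa_pullback`); the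
degree-`d` Frobenius case uses the Rmk. 5.3.3 identity `κ(F₂) · κ(F_d) = κ(F₂)^d` (`kappa_frobZero_mul`).
No statement of either paper is restated as a fact; nothing here bears on [IUTchIII] Cor. 3.12.
-/

namespace Literature.AlgebraicGeometry.Frobenioids

open CategoryTheory Opposite

universe w v u

namespace ModelFrobenioid

variable {D : Type u} [Category.{v} D] {Φ B : Dᵒᵖ ⥤ CommMonCat.{w}} {DivB : B ⟶ monoidGp Φ}

section RelHelpers

/-- Relation (d) for a linear base-identity unit-free arrow `(1, id, w, 1) : (A, γ) → (A, δ)` with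
`γ + w = δ`. [cite: MochizukiFrdI2008, Thm. 5.2(i) p.100] -/
theorem rel_step {A : D} {γ δ : Algebra.GrothendieckGroup (Φ.obj (op A))} {w : Φ.obj (op A)}
    (h : γ * Algebra.GrothendieckGroup.of w = δ) :
    γ ^ ((1 : ℕ+) : ℕ) * Algebra.GrothendieckGroup.of w = pullGp Φ (𝟙 A) δ * divB Φ B DivB (op A) 1 := by
  rw [PNat.one_coe, pow_one, pullGp_id, map_one, mul_one]
  exact h

/-- Relation (d) for the Frobenius morphism `(d, id, 0, 1) : (A, γ) → (A, d·γ)`.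
[cite: MochizukiFrdI2008, Thm. 5.2(i) p.100] -/
theorem rel_frob {A : D} (γ : Algebra.GrothendieckGroup (Φ.obj (op A))) (d : ℕ+) :
    γ ^ (d : ℕ) * Algebra.GrothendieckGroup.of 1 = pullGp Φ (𝟙 A) (γ ^ (d : ℕ)) * divB Φ B DivB (op A) 1 := by
  simp only [map_one, mul_one, pullGp_id]

/-- Relation (d) for the Frobenius endomorphism `(d, id, 0, 1)` of `(A, 0)`.
[cite: MochizukiFrdI2008, Thm. 5.2(iii) p.101] -/
theorem rel_frobZero (A : D) (d : ℕ+) :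
    (1 : Algebra.GrothendieckGroup (Φ.obj (op A))) ^ (d : ℕ) * Algebra.GrothendieckGroup.of 1 =
      pullGp Φ (𝟙 A) 1 * divB Φ B DivB (op A) 1 := by
  simp only [one_pow, map_one, mul_one]

/-- The class equation of a linear base-identity unit-free arrow `s : X → (Base X, δ)`:
`cls X + Div(s) = δ`. [cite: MochizukiFrdI2008, Thm. 5.2(i) p.100] -/
theorem cls_mul_of_div_eq {X : ModelFrobenioid Φ B DivB}
    {δ : Algebra.GrothendieckGroup (Φ.obj (op X.base))} (s : X ⟶ ⟨X.base, δ⟩)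
    (h1 : degFr s = 1) (hb : baseMap s = 𝟙 X.base) (hu : unit s = 1) :
    X.cls * Algebra.GrothendieckGroup.of (div s) = δ := by
  have h := rel s
  rw [h1, PNat.one_coe, pow_one, hb, pullGp_id, hu, map_one, mul_one] at h
  exact h

end RelHelpers

section Cocycle

variable (hB : ∀ (A : Dᵒᵖ) (b : B.obj A), IsUnit b)
  (κ : ∀ ⦃X Y : ModelFrobenioid Φ B DivB⦄, (X ⟶ Y) → B.obj (op X.base))
  (hκc : ∀ ⦃X Y Z : ModelFrobenioid Φ B DivB⦄ (φ : X ⟶ Y) (ψ : Y ⟶ Z),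
    κ (φ ≫ ψ) = pull B (baseMap φ) (κ ψ) * κ φ ^ (degFr ψ : ℕ))
  (hκr : ∀ ⦃X Y : ModelFrobenioid Φ B DivB⦄ (f g : X ⟶ Y), degFr f = 1 → degFr g = 1 →
    baseMap f = baseMap g → κ f * unit g = κ g * unit f)

include hκc in
/-- (K1) for a post-composition with a LINEAR arrow: `κ(ψ ∘ φ) = Base(φ)^* κ(ψ) · κ(φ)`.
[cite: MochizukiFrdI2008, Thm. 5.2(i) p.100] -/
theorem kappa_comp_of_degFr_eq_one {X Y Z : ModelFrobenioid Φ B DivB} (φ : X ⟶ Y) (ψ : Y ⟶ Z)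
    (hψ : degFr ψ = 1) : κ (φ ≫ ψ) = pull B (baseMap φ) (κ ψ) * κ φ := by
  rw [hκc, hψ, PNat.one_coe, pow_one]

include hB hκc in
/-- **[IUTchI] Rmk. 5.3.3 (`c_p = c_2^{p−1}`) for a twisted cocycle**: for the Frobenius endomorphisms
`F₂ = (2, id, 0, 1)`, `F_d = (d, id, 0, 1)` of `(A, 0)` — which commute — (K1) gives
`κ(F_d) κ(F₂)^d = κ(F₂) κ(F_d)^2`, whence `κ(F₂) · κ(F_d) = κ(F₂)^d`.
[cite: MochizukiFrdI2008, Prop. 5.6 p.105] -/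
theorem kappa_frobZero_mul (A : D) (d : ℕ+) (F₂ Fd : (⟨A, 1⟩ : ModelFrobenioid Φ B DivB) ⟶ ⟨A, 1⟩)
    (h2 : degFr F₂ = 2) (h2b : baseMap F₂ = 𝟙 A) (h2d : div F₂ = 1) (h2u : unit F₂ = 1)
    (hd : degFr Fd = d) (hdb : baseMap Fd = 𝟙 A) (hdd : div Fd = 1) (hdu : unit Fd = 1) :
    κ F₂ * κ Fd = κ F₂ ^ (d : ℕ) := by
  have hcomm : F₂ ≫ Fd = Fd ≫ F₂ := by
    refine hom_ext ?_ ?_ ?_ ?_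
    · show degFr Fd * degFr F₂ = degFr F₂ * degFr Fd
      exact mul_comm _ _
    · show baseMap F₂ ≫ baseMap Fd = baseMap Fd ≫ baseMap F₂
      rw [h2b, hdb]
    · show pull Φ (baseMap F₂) (div Fd) * div F₂ ^ (degFr Fd : ℕ) =
        pull Φ (baseMap Fd) (div F₂) * div Fd ^ (degFr F₂ : ℕ)
      rw [h2d, hdd, map_one, map_one, one_pow, one_pow]
    · show pull B (baseMap F₂) (unit Fd) * unit F₂ ^ (degFr Fd : ℕ) =
        pull B (baseMap Fd) (unit F₂) * unit Fd ^ (degFr F₂ : ℕ)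
      rw [h2u, hdu, map_one, map_one, one_pow, one_pow]
  have h₁ := hκc F₂ Fd
  have h₂ := hκc Fd F₂
  rw [h2b, pull_id, hd] at h₁
  rw [hdb, pull_id, h2, show (((2 : ℕ+) : ℕ)) = 2 from rfl, ← hcomm, h₁] at h₂
  -- `h₂ : κ Fd * κ F₂ ^ d = κ F₂ * κ Fd ^ 2`; cancel `κ Fd`
  refine ((hB _ (κ Fd)).mul_left_cancel ?_).symm
  calc κ Fd * κ F₂ ^ (d : ℕ) = κ F₂ * κ Fd ^ 2 := h₂
    _ = κ Fd * (κ F₂ * κ Fd) := by rw [pow_two, mul_left_comm, ← mul_assoc, mul_comm (κ Fd) (κ F₂)]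

include hκc hκr in
/-- **Independence of the fraction presentation.**  For two linear base-identity unit-free arrows
`s : X → (A, δ)`, `s' : X → (A, δ')` out of `X` and two such arrows `s₀ : (A, 0) → (A, δ)`, `s₀' : (A, 0) →
(A, δ')` out of the Frobenius-trivial object (two "fraction presentations" `cls X = Div(s₀) − Div(s) =
Div(s₀') − Div(s')`), `κ(s) · κ(s₀') = κ(s') · κ(s₀)`: compose into the common target `(A, δ + Div(s'))`
by pre-steps; (K1) and (K2) on the two parallel linear arrows out of `(A, 0)`.
[cite: MochizukiFrdI2008, Thm. 5.2(iv) p.102] -/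
theorem kappa_frac_indep (X : ModelFrobenioid Φ B DivB) (hBX : ∀ b : B.obj (op X.base), IsUnit b)
    {δ δ' : Algebra.GrothendieckGroup (Φ.obj (op X.base))}
    (s : X ⟶ ⟨X.base, δ⟩) (hs1 : degFr s = 1) (hsb : baseMap s = 𝟙 X.base) (hsu : unit s = 1)
    (s₀ : (⟨X.base, 1⟩ : ModelFrobenioid Φ B DivB) ⟶ ⟨X.base, δ⟩)
    (hs₀1 : degFr s₀ = 1) (hs₀b : baseMap s₀ = 𝟙 X.base) (hs₀u : unit s₀ = 1)
    (s' : X ⟶ ⟨X.base, δ'⟩) (hs'1 : degFr s' = 1) (hs'b : baseMap s' = 𝟙 X.base) (hs'u : unit s' = 1)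
    (s₀' : (⟨X.base, 1⟩ : ModelFrobenioid Φ B DivB) ⟶ ⟨X.base, δ'⟩)
    (hs₀'1 : degFr s₀' = 1) (hs₀'b : baseMap s₀' = 𝟙 X.base) (hs₀'u : unit s₀' = 1) :
    κ s * κ s₀' = κ s' * κ s₀ := by
  have hδ := cls_mul_of_div_eq s hs1 hsb hsu
  have hδ' := cls_mul_of_div_eq s' hs'1 hs'b hs'u
  -- the common target `T = (A, δ + Div s')` and the two pre-steps into it
  have hT : δ' * Algebra.GrothendieckGroup.of (div s) = δ * Algebra.GrothendieckGroup.of (div s') :=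
    calc δ' * Algebra.GrothendieckGroup.of (div s)
        = X.cls * Algebra.GrothendieckGroup.of (div s') * Algebra.GrothendieckGroup.of (div s) := by rw [hδ']
      _ = X.cls * Algebra.GrothendieckGroup.of (div s) * Algebra.GrothendieckGroup.of (div s') :=
          mul_right_comm _ _ _
      _ = δ * Algebra.GrothendieckGroup.of (div s') := by rw [hδ]
  let t₁ : (⟨X.base, δ⟩ : ModelFrobenioid Φ B DivB) ⟶ ⟨X.base, δ * Algebra.GrothendieckGroup.of (div s')⟩ :=
    mkHom _ _ 1 (𝟙 X.base) (div s' :) 1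
      (rel_step (B := B) (DivB := DivB) (γ := δ) (δ := δ * Algebra.GrothendieckGroup.of (div s')) (w := div s') rfl)
  let t₂ : (⟨X.base, δ'⟩ : ModelFrobenioid Φ B DivB) ⟶ ⟨X.base, δ * Algebra.GrothendieckGroup.of (div s')⟩ :=
    mkHom _ _ 1 (𝟙 X.base) (div s :) 1
      (rel_step (B := B) (DivB := DivB) (γ := δ') (δ := δ * Algebra.GrothendieckGroup.of (div s')) (w := div s) hT)
  -- (B) the two composites out of `X` are the same arrow `(1, id, Div s + Div s', 1)`
  have hB' : s ≫ t₁ = s' ≫ t₂ := by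
    refine hom_ext ?_ ?_ ?_ ?_
    · show degFr t₁ * degFr s = degFr t₂ * degFr s'
      rw [hs1, hs'1]
      rfl
    · show baseMap s ≫ baseMap t₁ = baseMap s' ≫ baseMap t₂
      rw [hsb, hs'b]
      rfl
    · show pull Φ (baseMap s) (div t₁) * div s ^ (degFr t₁ : ℕ) =
        pull Φ (baseMap s') (div t₂) * div s' ^ (degFr t₂ : ℕ)
      rw [hsb, hs'b, pull_id, pull_id]
      show div s' * div s ^ ((1 : ℕ+) : ℕ) = div s * div s' ^ ((1 : ℕ+) : ℕ)
      rw [PNat.one_coe, pow_one, pow_one, mul_comm]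
    · show pull B (baseMap s) (unit t₁) * unit s ^ (degFr t₁ : ℕ) =
        pull B (baseMap s') (unit t₂) * unit s' ^ (degFr t₂ : ℕ)
      rw [hsu, hs'u, one_pow, one_pow]
      show pull B (baseMap s) 1 * 1 = pull B (baseMap s') 1 * 1
      rw [map_one, map_one]
  have eB : κ t₁ * κ s = κ t₂ * κ s' := by
    have h := congrArg (fun φ => κ φ) hB'
    rw [kappa_comp_of_degFr_eq_one κ hκc s t₁ rfl, kappa_comp_of_degFr_eq_one κ hκc s' t₂ rfl,
      hsb, hs'b, pull_id, pull_id] at h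
    exact h
  -- (A) the two composites out of `(A, 0)` are PARALLEL LINEAR arrows with trivial units: (K2)
  have eA : κ t₁ * κ s₀ = κ t₂ * κ s₀' := by
    have h := hκr (s₀ ≫ t₁) (s₀' ≫ t₂)
      (by show degFr t₁ * degFr s₀ = 1; rw [hs₀1]; rfl)
      (by show degFr t₂ * degFr s₀' = 1; rw [hs₀'1]; rfl)
      (by show baseMap s₀ ≫ baseMap t₁ = baseMap s₀' ≫ baseMap t₂; rw [hs₀b, hs₀'b]; rfl)
    rw [kappa_comp_of_degFr_eq_one κ hκc s₀ t₁ rfl, kappa_comp_of_degFr_eq_one κ hκc s₀' t₂ rfl,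
      hs₀b, hs₀'b, pull_id, pull_id] at h
    have hu₁ : unit (s₀ ≫ t₁) = 1 := by
      show pull B (baseMap s₀) (unit t₁) * unit s₀ ^ (degFr t₁ : ℕ) = 1
      rw [hs₀u, one_pow, mul_one]
      show pull B (baseMap s₀) 1 = 1
      rw [map_one]
    have hu₂ : unit (s₀' ≫ t₂) = 1 := by
      show pull B (baseMap s₀') (unit t₂) * unit s₀' ^ (degFr t₂ : ℕ) = 1
      rw [hs₀'u, one_pow, mul_one]
      show pull B (baseMap s₀') 1 = 1
      rw [map_one]
    rw [hu₁, hu₂, mul_one, mul_one] at h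
    exact h
  -- cancel the unit `κ t₁ · κ t₂`
  refine (hBX (κ t₁ * κ t₂)).mul_left_cancel ?_
  calc κ t₁ * κ t₂ * (κ s * κ s₀') = (κ t₁ * κ s) * (κ t₂ * κ s₀') := by ac_rfl
    _ = (κ t₂ * κ s') * (κ t₁ * κ s₀) := by rw [eB, eA]
    _ = κ t₁ * κ t₂ * (κ s' * κ s₀) := by ac_rfl

include hB hκc hκr in
/-- **The units `ω_X` exist** (the "various units obtained in Proposition 5.6"): for every object `X` there
is `ω_X ∈ B(Base X)` with `ω_X · κ(s₀) = κ(F) · κ(s)` for EVERY fraction presentation `(s, s₀)` of `X` and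
the degree-`2` Frobenius endomorphism `F` of `(Base X, 0)`; at `X = (A, 0)` itself (`s = s₀`), `ω = κ(F)` is
Rmk. 5.3.3's `c₂`. [cite: MochizukiFrdI2008, Prop. 5.6 p.105] -/
theorem exists_omega (X : ModelFrobenioid Φ B DivB) :
    ∃ ω : B.obj (op X.base), ∀ ⦃δ : Algebra.GrothendieckGroup (Φ.obj (op X.base))⦄
      (s : X ⟶ ⟨X.base, δ⟩) (s₀ : (⟨X.base, 1⟩ : ModelFrobenioid Φ B DivB) ⟶ ⟨X.base, δ⟩)
      (F : (⟨X.base, 1⟩ : ModelFrobenioid Φ B DivB) ⟶ ⟨X.base, 1⟩),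
      degFr s = 1 → baseMap s = 𝟙 X.base → unit s = 1 →
      degFr s₀ = 1 → baseMap s₀ = 𝟙 X.base → unit s₀ = 1 →
      degFr F = 2 → baseMap F = 𝟙 X.base → div F = 1 → unit F = 1 →
        ω * κ s₀ = κ F * κ s := by
  -- one fraction presentation `cls X = x − y`
  obtain ⟨x, y, hxy⟩ := exists_cls_eq_div X
  have hxy' : X.cls * Algebra.GrothendieckGroup.of y = Algebra.GrothendieckGroup.of x :=
    eq_div_iff_mul_eq'.mp hxy
  let s₁ : X ⟶ ⟨X.base, X.cls * Algebra.GrothendieckGroup.of y⟩ := mkHom _ _ 1 (𝟙 X.base) y 1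
    (rel_step (B := B) (DivB := DivB) (γ := X.cls) (δ := X.cls * Algebra.GrothendieckGroup.of y) (w := y) rfl)
  let s₁₀ : (⟨X.base, 1⟩ : ModelFrobenioid Φ B DivB) ⟶ ⟨X.base, X.cls * Algebra.GrothendieckGroup.of y⟩ :=
    mkHom _ _ 1 (𝟙 X.base) x 1
      (rel_step (B := B) (DivB := DivB) (γ := 1) (δ := X.cls * Algebra.GrothendieckGroup.of y) (w := x)
        (by rw [one_mul]; exact hxy'.symm))
  let F₁ : (⟨X.base, 1⟩ : ModelFrobenioid Φ B DivB) ⟶ ⟨X.base, 1⟩ :=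
    mkHom _ _ 2 (𝟙 X.base) 1 1 (rel_frobZero X.base 2)
  obtain ⟨ι, hι⟩ := hB _ (κ s₁₀)
  refine ⟨κ F₁ * κ s₁ * ↑ι⁻¹, ?_⟩
  intro δ s s₀ F hs1 hsb hsu hs₀1 hs₀b hs₀u hF2 hFb hFd hFu
  -- `F = F₁`
  have hF : F = F₁ := hom_ext hF2 hFb hFd hFu
  -- fraction independence: `κ s₁ · κ s₀ = κ s · κ s₁₀`
  have hind := kappa_frac_indep κ hκc hκr X (hB _) s₁ rfl rfl rfl s₁₀ rfl rfl rfl s hs1 hsb hsu s₀ hs₀1 hs₀b hs₀u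
  rw [hF]
  calc κ F₁ * κ s₁ * ↑ι⁻¹ * κ s₀ = κ F₁ * ↑ι⁻¹ * (κ s₁ * κ s₀) := by ac_rfl
    _ = κ F₁ * ↑ι⁻¹ * (κ s * κ s₁₀) := by rw [hind]
    _ = κ F₁ * κ s * (↑ι⁻¹ * ↑ι) := by rw [hι]; ac_rfl
    _ = κ F₁ * κ s := by rw [Units.inv_mul, mul_one]

include hB hκc in
/-- **Coboundary identity along the Frobenius morphism** `Fr = (d, id, 0, 1) : X = (A, γ) → (A, d·γ)`:
`κ(Fr) · ω_{(A, dγ)} = ω_X^d`.  From (K1) on the two squares `Fr ∘ s = s_d ∘ Fr` (pre-steps `s : X → (A, x)`,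
`s_d : (A, dγ) → (A, d x)` of a fraction `γ = x − y`) and `F_d ∘ s₀ = s₀^d ∘ Fr`, the unit characterisation
of `ω`, and Rmk. 5.3.3 `κ(F₂) κ(F_d) = κ(F₂)^d`. [cite: MochizukiFrdI2008, Thm. 5.2(iv) p.102] -/
theorem kappa_frob (X : ModelFrobenioid Φ B DivB) (d : ℕ+)
    (Fr : X ⟶ ⟨X.base, X.cls ^ (d : ℕ)⟩) (hFr : degFr Fr = d) (hFb : baseMap Fr = 𝟙 X.base)
    (hFd : div Fr = 1) (hFu : unit Fr = 1) (ωX ωXd : B.obj (op X.base))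
    (HX : ∀ ⦃δ : Algebra.GrothendieckGroup (Φ.obj (op X.base))⦄
      (s : X ⟶ ⟨X.base, δ⟩) (s₀ : (⟨X.base, 1⟩ : ModelFrobenioid Φ B DivB) ⟶ ⟨X.base, δ⟩)
      (F : (⟨X.base, 1⟩ : ModelFrobenioid Φ B DivB) ⟶ ⟨X.base, 1⟩),
      degFr s = 1 → baseMap s = 𝟙 X.base → unit s = 1 →
      degFr s₀ = 1 → baseMap s₀ = 𝟙 X.base → unit s₀ = 1 →
      degFr F = 2 → baseMap F = 𝟙 X.base → div F = 1 → unit F = 1 → ωX * κ s₀ = κ F * κ s)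
    (HXd : ∀ ⦃δ : Algebra.GrothendieckGroup (Φ.obj (op X.base))⦄
      (s : (⟨X.base, X.cls ^ (d : ℕ)⟩ : ModelFrobenioid Φ B DivB) ⟶ ⟨X.base, δ⟩)
      (s₀ : (⟨X.base, 1⟩ : ModelFrobenioid Φ B DivB) ⟶ ⟨X.base, δ⟩)
      (F : (⟨X.base, 1⟩ : ModelFrobenioid Φ B DivB) ⟶ ⟨X.base, 1⟩),
      degFr s = 1 → baseMap s = 𝟙 X.base → unit s = 1 →
      degFr s₀ = 1 → baseMap s₀ = 𝟙 X.base → unit s₀ = 1 →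
      degFr F = 2 → baseMap F = 𝟙 X.base → div F = 1 → unit F = 1 → ωXd * κ s₀ = κ F * κ s) :
    κ Fr * pull B (baseMap Fr) ωXd = unit Fr * ωX ^ (degFr Fr : ℕ) := by
  obtain ⟨x, y, hxy⟩ := exists_cls_eq_div X
  have hxy' : X.cls * Algebra.GrothendieckGroup.of y = Algebra.GrothendieckGroup.of x :=
    eq_div_iff_mul_eq'.mp hxy
  have hxyd : X.cls ^ (d : ℕ) * Algebra.GrothendieckGroup.of (y ^ (d : ℕ)) =
      Algebra.GrothendieckGroup.of (x ^ (d : ℕ)) := by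
    rw [map_pow, ← mul_pow, hxy', map_pow]
  -- the presentations of `X` and of `X_d = (A, dγ)`, the Frobenius arrows of `(A, 0)` and of `(A, x)`
  let s : X ⟶ ⟨X.base, X.cls * Algebra.GrothendieckGroup.of y⟩ := mkHom _ _ 1 (𝟙 X.base) y 1
    (rel_step (B := B) (DivB := DivB) (γ := X.cls) (δ := X.cls * Algebra.GrothendieckGroup.of y) (w := y) rfl)
  let s₀ : (⟨X.base, 1⟩ : ModelFrobenioid Φ B DivB) ⟶ ⟨X.base, X.cls * Algebra.GrothendieckGroup.of y⟩ :=
    mkHom _ _ 1 (𝟙 X.base) x 1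
      (rel_step (B := B) (DivB := DivB) (γ := 1) (δ := X.cls * Algebra.GrothendieckGroup.of y) (w := x)
        (by rw [one_mul]; exact hxy'.symm))
  let sd : (⟨X.base, X.cls ^ (d : ℕ)⟩ : ModelFrobenioid Φ B DivB) ⟶
      ⟨X.base, X.cls ^ (d : ℕ) * Algebra.GrothendieckGroup.of (y ^ (d : ℕ))⟩ :=
    mkHom _ _ 1 (𝟙 X.base) (y ^ (d : ℕ)) 1
      (rel_step (B := B) (DivB := DivB) (γ := X.cls ^ (d : ℕ))
        (δ := X.cls ^ (d : ℕ) * Algebra.GrothendieckGroup.of (y ^ (d : ℕ))) (w := y ^ (d : ℕ)) rfl)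
  let s₀d : (⟨X.base, 1⟩ : ModelFrobenioid Φ B DivB) ⟶
      ⟨X.base, X.cls ^ (d : ℕ) * Algebra.GrothendieckGroup.of (y ^ (d : ℕ))⟩ :=
    mkHom _ _ 1 (𝟙 X.base) (x ^ (d : ℕ)) 1
      (rel_step (B := B) (DivB := DivB) (γ := 1)
        (δ := X.cls ^ (d : ℕ) * Algebra.GrothendieckGroup.of (y ^ (d : ℕ))) (w := x ^ (d : ℕ))
        (by rw [one_mul]; exact hxyd.symm))
  let F₂ : (⟨X.base, 1⟩ : ModelFrobenioid Φ B DivB) ⟶ ⟨X.base, 1⟩ :=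
    mkHom _ _ 2 (𝟙 X.base) 1 1 (rel_frobZero X.base 2)
  let Fd : (⟨X.base, 1⟩ : ModelFrobenioid Φ B DivB) ⟶ ⟨X.base, 1⟩ :=
    mkHom _ _ d (𝟙 X.base) 1 1 (rel_frobZero X.base d)
  let Fx : (⟨X.base, X.cls * Algebra.GrothendieckGroup.of y⟩ : ModelFrobenioid Φ B DivB) ⟶
      ⟨X.base, X.cls ^ (d : ℕ) * Algebra.GrothendieckGroup.of (y ^ (d : ℕ))⟩ :=
    mkHom _ _ d (𝟙 X.base) 1 1 (by
      rw [map_one, mul_one, map_one, mul_one, pullGp_id, mul_pow, ← map_pow])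
  have hX := HX s s₀ F₂ rfl rfl rfl rfl rfl rfl rfl rfl rfl rfl
  have hXd := HXd sd s₀d F₂ rfl rfl rfl rfl rfl rfl rfl rfl rfl rfl
  have hFdeg : κ F₂ * κ Fd = κ F₂ ^ (d : ℕ) :=
    kappa_frobZero_mul hB κ hκc X.base d F₂ Fd rfl rfl rfl rfl rfl rfl rfl rfl
  -- (E7) `Fr ∘ s = sd ∘ Fr` read by `κ`
  have e7 : κ Fx * κ s ^ (d : ℕ) = κ sd * κ Fr := by
    have hsq : s ≫ Fx = Fr ≫ sd := by
      refine hom_ext ?_ ?_ ?_ ?_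
      · show degFr Fx * degFr s = degFr sd * degFr Fr
        rw [hFr]
        show d * 1 = 1 * d
        rw [mul_one, one_mul]
      · show 𝟙 X.base ≫ 𝟙 X.base = baseMap Fr ≫ 𝟙 X.base
        rw [hFb]
      · show pull Φ (𝟙 X.base) 1 * y ^ (d : ℕ) = pull Φ (baseMap Fr) (y ^ (d : ℕ)) * div Fr ^ ((1 : ℕ+) : ℕ)
        rw [hFb, hFd]
        simp only [map_one, one_mul, pull_id, one_pow, mul_one]
      · show pull B (𝟙 X.base) 1 * (1 : B.obj (op X.base)) ^ (d : ℕ) =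
          pull B (baseMap Fr) 1 * unit Fr ^ ((1 : ℕ+) : ℕ)
        rw [hFu]
        simp only [map_one, one_pow, mul_one]
    have h := congrArg (fun φ => κ φ) hsq
    rw [hκc s Fx, hκc Fr sd, hFb] at h
    have h' : pull B (𝟙 X.base) (κ Fx :) * κ s ^ (d : ℕ) = pull B (𝟙 X.base) (κ sd :) * κ Fr ^ ((1 : ℕ+) : ℕ) := h
    rw [pull_id, pull_id, PNat.one_coe, pow_one] at h'
    exact h'
  -- (E3) `Fr_x ∘ s₀ = s₀^d ∘ F_d` read by `κ`
  have e3 : κ Fx * κ s₀ ^ (d : ℕ) = κ s₀d * κ Fd := by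
    have hsq : s₀ ≫ Fx = Fd ≫ s₀d := by
      refine hom_ext ?_ ?_ ?_ ?_
      · show degFr Fx * degFr s₀ = degFr s₀d * degFr Fd
        show d * 1 = 1 * d
        rw [mul_one, one_mul]
      · rfl
      · show pull Φ (baseMap s₀) (div Fx) * div s₀ ^ (degFr Fx : ℕ) =
          pull Φ (baseMap Fd) (div s₀d) * div Fd ^ (degFr s₀d : ℕ)
        show pull Φ (𝟙 X.base) 1 * x ^ (d : ℕ) = pull Φ (𝟙 X.base) (x ^ (d : ℕ)) * 1 ^ ((1 : ℕ+) : ℕ)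
        rw [map_one, one_mul, pull_id, one_pow, mul_one]
      · show pull B (baseMap s₀) (unit Fx) * unit s₀ ^ (degFr Fx : ℕ) =
          pull B (baseMap Fd) (unit s₀d) * unit Fd ^ (degFr s₀d : ℕ)
        show pull B (𝟙 X.base) 1 * 1 ^ (d : ℕ) = pull B (𝟙 X.base) 1 * 1 ^ ((1 : ℕ+) : ℕ)
        rw [one_pow, one_pow]
    have h := congrArg (fun φ => κ φ) hsq
    rw [hκc s₀ Fx, hκc Fd s₀d] at h
    have h' : pull B (𝟙 X.base) (κ Fx :) * κ s₀ ^ (d : ℕ) = pull B (𝟙 X.base) (κ s₀d :) * κ Fd ^ ((1 : ℕ+) : ℕ) := h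
    rw [pull_id, pull_id, PNat.one_coe, pow_one] at h'
    exact h'
  -- assemble, cancelling the unit `κ s₀d · κ s₀ ^ d`
  rw [hFb, pull_id, hFu, one_mul, hFr]
  refine (hB _ (κ s₀d * κ s₀ ^ (d : ℕ))).mul_left_cancel ?_
  calc κ s₀d * κ s₀ ^ (d : ℕ) * (κ Fr * ωXd) = κ Fr * (ωXd * κ s₀d) * κ s₀ ^ (d : ℕ) := by ac_rfl
    _ = κ Fr * (κ F₂ * κ sd) * κ s₀ ^ (d : ℕ) := by rw [hXd]
    _ = κ F₂ * (κ sd * κ Fr) * κ s₀ ^ (d : ℕ) := by ac_rfl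
    _ = κ F₂ * (κ Fx * κ s ^ (d : ℕ)) * κ s₀ ^ (d : ℕ) := by rw [e7]
    _ = κ F₂ * κ s ^ (d : ℕ) * (κ Fx * κ s₀ ^ (d : ℕ)) := by ac_rfl
    _ = κ F₂ * κ s ^ (d : ℕ) * (κ s₀d * κ Fd) := by rw [e3]
    _ = (κ F₂ * κ Fd) * κ s ^ (d : ℕ) * κ s₀d := by ac_rfl
    _ = (κ F₂ * κ s) ^ (d : ℕ) * κ s₀d := by rw [hFdeg, mul_pow]
    _ = (ωX * κ s₀) ^ (d : ℕ) * κ s₀d := by rw [hX]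
    _ = κ s₀d * κ s₀ ^ (d : ℕ) * ωX ^ (d : ℕ) := by rw [mul_pow]; ac_rfl

end Cocycle

end ModelFrobenioid

end Literature.AlgebraicGeometry.Frobenioids
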